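import Summits.Parity.BatemanHorn.Theses.AlmostPrimeZeros
import Summits.Parity.BatemanHorn.Theorems.SystemLSDRealSegment.Negative.Engines
import Summits.Parity.BatemanHorn.Theorems.SystemLSDRealSegment.Negative.DivisorBound

/-!
# `SystemLSDRealSegment` — three fields of `IsBatemanHornSystem` are load-bearing, the fourth is not

Negative-side theorems for the crux `Summit.Parity.BatemanHorn.Theses.AlmostPrimeZeros.SystemLSDRealSegment`
(stmt-Parity-11292), from the standing disprover's work file `Cruxes/SystemLSDRealSegment/Disproof.lean` §3.
For each field `H` of the hypothesis `IsBatemanHornSystem f` we state the crux WITH `H` DROPPED (the conclusion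
inlined verbatim) and decide it:

* `false_without_leadingCoeff_pos` — witness `![-X]`: the typed statistic (`Int.toNat`) vanishes, the normalised
  sum tends to `0` on the segment, so `Λ ≡ 0` there and `Λ 0 = 0` by the identity theorem, against `C(-X) = 1`;
* `false_without_irreducible` — witness `![X ^ 2]` at `y = 3/2`: `s(n²) = 2ω(n)`, `Σ y^{s} ≥ Σ 2^{ω} ≥
  (x/2) log x - x`, the normalised sum diverges;
* `false_without_pairwise_not_associated` — witness `![X, X]` at `y = 29/20`: `s = 2 s(n) ≥ 2 ω(n)`, diverges;
* `conclusion_C_three` — the junk model `![C 3]` (fixed prime divisor `3`, the three other fields hold)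
  SATISFIES the conclusion (`Λ ≡ 0 = C`): `hasNoFixedPrimeDivisor` is not what a disproof can lean on.
-/

open Filter Polynomial Finset
open scoped Topology

namespace Summit.Parity.BatemanHorn.Theorems.SystemLSDRealSegment.Negative

open Literature.NumberTheory.Sieve

/-! ## Common bookkeeping -/

/-- The complex normalised sum of the crux is the real one coerced. [folklore] -/
theorem normSum_eq_ofReal (k : ℕ) (f : Fin k → ℤ[X]) (y : ℝ) (x : ℕ) :
    (x : ℂ)⁻¹ * Complex.exp ((k : ℂ) * (1 - (y : ℂ)) * (Real.log (Real.log x) : ℂ)) *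
        ∑ n ∈ Finset.range (x + 1), (y : ℂ) ^ (∑ i, (((f i).eval (n : ℤ)).toNat.factorization.sum
            fun _ v => min v 2)) =
      (((x : ℝ)⁻¹ * Real.exp (k * (1 - y) * Real.log (Real.log x)) *
        ∑ n ∈ Finset.range (x + 1), y ^ (∑ i, (((f i).eval (n : ℤ)).toNat.factorization.sum
            fun _ v => min v 2)) : ℝ) : ℂ) := by
  push_cast
  rfl

/-- If `p ∣ ∏ f_i(n) ↔ p ∣ n` for every prime `p` then `ω_f(p) = 1` (only the residue `0`). [folklore] -/
theorem polyRootCountMod_eq_one {k : ℕ} {f : Fin k → ℤ[X]}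
    (hf : ∀ p : ℕ, p.Prime → ∀ n : ℕ, ((p : ℤ) ∣ ∏ i, (f i).eval (n : ℤ)) ↔ p ∣ n)
    {p : ℕ} (hp : p.Prime) : polyRootCountMod f p = 1 := by
  unfold polyRootCountMod
  have : ((Finset.range p).filter fun n : ℕ => (p : ℤ) ∣ ∏ i, (f i).eval (n : ℤ)) = {0} := by
    ext n
    simp only [Finset.mem_filter, Finset.mem_range, Finset.mem_singleton, hf p hp]
    constructor
    · rintro ⟨hn, hdvd⟩
      exact Nat.eq_zero_of_dvd_of_lt hdvd hn
    · rintro rfl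
      exact ⟨hp.pos, dvd_zero p⟩
  rw [this, Finset.card_singleton]

/-- … then every ordered partial product of a ONE-polynomial family is `1`, so `C(f) = 1`. [folklore] -/
theorem batemanHornConst_eq_one {f : Fin 1 → ℤ[X]} (h : ∀ p : ℕ, p.Prime → polyRootCountMod f p = 1) :
    batemanHornConst f = 1 := by
  have hpart : batemanHornPartial f = fun _ => 1 := by
    funext x
    unfold batemanHornPartial
    refine Finset.prod_eq_one fun p hp => ?_
    have hp' := Nat.prime_of_mem_primesLE hp
    have hp0 : (0 : ℝ) < p := by exact_mod_cast hp'.pos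
    have hlt : 1 / (p : ℝ) < 1 := by rw [div_lt_one hp0]; exact_mod_cast hp'.one_lt
    rw [h p hp', Fintype.card_fin, pow_one, Nat.cast_one]
    exact inv_mul_cancel₀ (by linarith)
  rw [batemanHornConst, hpart]
  exact tendsto_const_nhds.limUnder_eq

/-! ## (a) `leadingCoeff_pos` is load-bearing — witness `![-X]` -/

/-- `p ∣ (-X)(n) ↔ p ∣ n`. [folklore] -/
theorem negX_dvd_iff (p : ℕ) (_hp : p.Prime) (n : ℕ) :
    ((p : ℤ) ∣ ∏ i, ((![-X] : Fin 1 → ℤ[X]) i).eval (n : ℤ)) ↔ p ∣ n := by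
  simp [Int.natCast_dvd_natCast]

/-- All values of `-X` on `ℕ` are `≤ 0`, so the typed statistic vanishes identically (`Int.toNat`). [folklore] -/
theorem stat_negX (n : ℕ) : (∑ i, ((((![-X] : Fin 1 → ℤ[X]) i).eval (n : ℤ)).toNat.factorization.sum
    fun _ v => min v 2)) = 0 := by simp

/-- DROP `leadingCoeff_pos` ⇒ FALSE. Witness `k = 1`, `f = ![-X]` (irreducible: `-X` is prime; `ω(p) = 1 < p`;
pairwise vacuous): `s_f ≡ 0`, so the normalised sum is `x⁻¹(x+1)(log x)^{1-y} → 0` on the segment, hence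
`Λ ≡ 0` there (the Γ-factor is non-zero), hence `Λ 0 = 0` by the identity theorem — but `C(-X) = 1`. The
witness lives on the `toNat` convention for non-positive values. [folklore] -/
theorem false_without_leadingCoeff_pos :
    ¬ ∀ (k : ℕ) (f : Fin k → ℤ[X]), (∀ i, Irreducible (f i)) →
      (Pairwise fun i j => ¬Associated (f i) (f j)) → HasNoFixedPrimeDivisor f →
      ∃ Λ : ℂ → ℂ, DifferentiableOn ℂ Λ (Metric.ball 0 2) ∧ Λ 0 = (batemanHornConst f : ℂ) ∧
        ∀ y : ℝ, 5 / 4 < y → y < 7 / 4 → Filter.Tendsto (fun x : ℕ => (x : ℂ)⁻¹ *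
          Complex.exp ((k : ℂ) * (1 - (y : ℂ)) * (Real.log (Real.log x) : ℂ)) *
          ∑ n ∈ Finset.range (x + 1), (y : ℂ) ^ (∑ i, (((f i).eval (n : ℤ)).toNat.factorization.sum
              fun _ v => min v 2))) Filter.atTop
          (nhds (Λ y * Complex.exp (((y : ℂ) - 1) * (Real.log (∏ i, ((f i).natDegree : ℝ)) : ℂ)) *
            (Complex.Gamma y)⁻¹ ^ k)) := by
  intro h
  obtain ⟨Λ, hΛ, hΛ0, hlaw⟩ := h 1 ![-X] (fun i => by simpa using Polynomial.prime_X.neg.irreducible)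
    Subsingleton.pairwise (fun p hp => by rw [polyRootCountMod_eq_one negX_dvd_iff hp]; exact hp.one_lt)
  have hvan : ∀ y : ℝ, 5 / 4 < y → y < 7 / 4 → Λ y = 0 := fun y hy hy' => by
    have hlim := (hlaw y hy hy').congr fun x => normSum_eq_ofReal 1 ![-X] y x
    have h0 : Tendsto (fun x : ℕ => (x : ℝ)⁻¹ * Real.exp ((1 : ℕ) * (1 - y) * Real.log (Real.log x)) *
        ∑ n ∈ Finset.range (x + 1), y ^ (∑ i, ((((![-X] : Fin 1
            → ℤ[X]) i).eval (n : ℤ)).toNat.factorization.sum fun _ v => min v 2))) atTop (𝓝 0) := by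
      refine (tendsto_zero_of_const_sum le_rfl (by linarith : (1 : ℝ) < y) 1).congr fun x => ?_
      simp
    have := eq_zero_of_tendsto_ofReal hlim h0
    rw [mul_assoc] at this
    exact (mul_eq_zero.1 this).resolve_right (gammaFactor_ne_zero 1 _ (by linarith))
  have h0 := apply_zero_eq_zero_of_vanish hΛ hvan
  rw [hΛ0, batemanHornConst_eq_one fun p hp => polyRootCountMod_eq_one negX_dvd_iff hp] at h0
  simp at h0

/-! ## (b) `irreducible` is load-bearing — witness `![X ^ 2]` -/

/-- `p ∣ n² ↔ p ∣ n`. [folklore] -/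
theorem sq_dvd_iff (p : ℕ) (hp : p.Prime) (n : ℕ) :
    ((p : ℤ) ∣ ∏ i, ((![X ^ 2] : Fin 1 → ℤ[X]) i).eval (n : ℤ)) ↔ p ∣ n := by
  simp only [Fin.prod_univ_one, Matrix.cons_val_fin_one, eval_pow, eval_X]
  rw [← Nat.cast_pow, Int.natCast_dvd_natCast]
  exact hp.prime.dvd_pow_iff_dvd two_ne_zero

/-- The CAP in action: `s(n²) = Σ_p min(2 v_p(n), 2) = 2 ω(n)`. [folklore] -/
theorem capped_sq (n : ℕ) : ((n ^ 2).factorization.sum fun _ v => min v 2) = 2 * n.primeFactors.card := by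
  rw [Nat.factorization_pow, Finsupp.sum_smul_index' (h := fun _ v => min v 2) (fun _ => rfl), Finsupp.sum,
    Nat.support_factorization, Finset.card_eq_sum_ones, Finset.mul_sum]
  refine Finset.sum_congr rfl fun p hp => ?_
  have h1 : 0 < n.factorization p := by
    obtain ⟨hp', hpn, hn⟩ := Nat.mem_primeFactors.1 hp
    exact hp'.factorization_pos_of_dvd hn hpn
  simp only [smul_eq_mul]
  omega

/-- `s_{![X²]}(n) = 2 ω(n)`. [folklore] -/
theorem stat_sq (n : ℕ) : (∑ i, ((((![X ^ 2] : Fin 1 → ℤ[X]) i).eval (n : ℤ)).toNat.factorization.sum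
    fun _ v => min v 2)) = 2 * n.primeFactors.card := by
  simp only [Fin.sum_univ_one, Matrix.cons_val_fin_one, eval_pow, eval_X]
  rw [← Nat.cast_pow, Int.toNat_natCast, capped_sq]

/-- `Σ_{n ≤ x} y^{s(n²)} ≥ (x/2) log x - x` once `y² ≥ 2`. [folklore] -/
theorem sum_stat_sq_ge {y : ℝ} (hy : 2 ≤ y ^ 2) (hy0 : 0 ≤ y) (x : ℕ) :
    (x : ℝ) / 2 * Real.log x - x ≤ ∑ n ∈ Finset.range (x + 1), y ^ (∑ i, ((((![X ^ 2] : Fin 1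
        → ℤ[X]) i).eval (n : ℤ)).toNat.factorization.sum fun _ v => min v 2)) := by
  refine (sum_two_pow_omega_ge x).trans ?_
  calc ∑ n ∈ Icc 1 x, (2 : ℝ) ^ n.primeFactors.card
      ≤ ∑ n ∈ Icc 1 x, y ^ (∑ i, ((((![X ^ 2] : Fin 1
          → ℤ[X]) i).eval (n : ℤ)).toNat.factorization.sum fun _ v => min v 2)) := by
        refine Finset.sum_le_sum fun n _ => ?_
        rw [stat_sq, pow_mul]
        exact pow_le_pow_left₀ (by norm_num) hy _
    _ ≤ ∑ n ∈ Finset.range (x + 1), y ^ (∑ i, ((((![X ^ 2] : Fin 1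
        → ℤ[X]) i).eval (n : ℤ)).toNat.factorization.sum fun _ v => min v 2)) :=
        Finset.sum_le_sum_of_subset_of_nonneg (fun n hn => by
          simp only [Finset.mem_Icc, Finset.mem_range] at hn ⊢; omega) fun _ _ _ => by positivity

/-- DROP `irreducible` ⇒ FALSE. Witness `k = 1`, `f = ![X²]` (leading coefficient `1 > 0`, `ω(p) = 1 < p`):
`s(n²) = 2ω(n)`, so at `y = 3/2` (`y² ≥ 2`, `k(y-1) = 1/2 < 1`) the normalised sum is
`≥ ½ (log x)^{1/2} - 1 → ∞`: no limit exists, whatever `Λ`. [folklore] -/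
theorem false_without_irreducible :
    ¬ ∀ (k : ℕ) (f : Fin k → ℤ[X]), (∀ i, 0 < (f i).leadingCoeff) →
      (Pairwise fun i j => ¬Associated (f i) (f j)) → HasNoFixedPrimeDivisor f →
      ∃ Λ : ℂ → ℂ, DifferentiableOn ℂ Λ (Metric.ball 0 2) ∧ Λ 0 = (batemanHornConst f : ℂ) ∧
        ∀ y : ℝ, 5 / 4 < y → y < 7 / 4 → Filter.Tendsto (fun x : ℕ => (x : ℂ)⁻¹ *
          Complex.exp ((k : ℂ) * (1 - (y : ℂ)) * (Real.log (Real.log x) : ℂ)) *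
          ∑ n ∈ Finset.range (x + 1), (y : ℂ) ^ (∑ i, (((f i).eval (n : ℤ)).toNat.factorization.sum
              fun _ v => min v 2))) Filter.atTop
          (nhds (Λ y * Complex.exp (((y : ℂ) - 1) * (Real.log (∏ i, ((f i).natDegree : ℝ)) : ℂ)) *
            (Complex.Gamma y)⁻¹ ^ k)) := by
  intro h
  obtain ⟨Λ, _, _, hlaw⟩ := h 1 ![X ^ 2] (fun i => by simp) Subsingleton.pairwise
    (fun p hp => by rw [polyRootCountMod_eq_one sq_dvd_iff hp]; exact hp.one_lt)
  have hlim := (hlaw (3 / 2) (by norm_num) (by norm_num)).congr fun x => normSum_eq_ofReal 1 ![X ^ 2] (3 / 2) x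
  refine not_tendsto_ofReal_of_tendsto_atTop ?_ _ hlim
  exact tendsto_atTop_of_lower_envelope (by norm_num) (by norm_num)
    fun x _ => sum_stat_sq_ge (by norm_num) (by norm_num) x

/-! ## (c) `pairwise_not_associated` is load-bearing — witness `![X, X]` -/

/-- `p ∣ n·n ↔ p ∣ n`. [folklore] -/
theorem pair_dvd_iff (p : ℕ) (hp : p.Prime) (n : ℕ) :
    ((p : ℤ) ∣ ∏ i, ((![X, X] : Fin 2 → ℤ[X]) i).eval (n : ℤ)) ↔ p ∣ n := by
  simp only [Fin.prod_univ_two, Matrix.cons_val_zero, Matrix.cons_val_one, eval_X]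
  rw [← Nat.cast_mul, Int.natCast_dvd_natCast]
  constructor
  · intro h2; rcases hp.dvd_mul.1 h2 with h2 | h2 <;> exact h2
  · intro h2; exact dvd_mul_of_dvd_left h2 n

/-- The capped statistic dominates `ω`: `Σ_p min(v_p(n), 2) ≥ ω(n)`. [folklore] -/
theorem omega_le_capped (n : ℕ) : n.primeFactors.card ≤ (n.factorization.sum fun _ v => min v 2) := by
  rw [Finsupp.sum, Nat.support_factorization, Finset.card_eq_sum_ones]
  refine Finset.sum_le_sum fun p hp => ?_
  obtain ⟨hp', hpn, hn⟩ := Nat.mem_primeFactors.1 hp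
  have := hp'.factorization_pos_of_dvd hn hpn
  omega

/-- `s_{![X,X]}(n) = 2 s(n)`. [folklore] -/
theorem stat_pair (n : ℕ) :
    (∑ i, ((((![X, X] : Fin 2 → ℤ[X]) i).eval (n : ℤ)).toNat.factorization.sum
        fun _ v => min v 2)) = 2 * (n.factorization.sum fun _ v => min v 2) := by
  simp only [Fin.sum_univ_two, Matrix.cons_val_zero, Matrix.cons_val_one, eval_X, Int.toNat_natCast]
  ring

/-- `Σ_{n ≤ x} y^{2 s(n)} ≥ (x/2) log x - x` once `y² ≥ 2`, `y ≥ 1`. [folklore] -/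
theorem sum_stat_pair_ge {y : ℝ} (hy : 2 ≤ y ^ 2) (hy1 : 1 ≤ y) (x : ℕ) :
    (x : ℝ) / 2 * Real.log x - x ≤ ∑ n ∈ Finset.range (x + 1), y ^ (∑ i, ((((![X, X] : Fin 2
        → ℤ[X]) i).eval (n : ℤ)).toNat.factorization.sum fun _ v => min v 2)) := by
  refine (sum_two_pow_omega_ge x).trans ?_
  calc ∑ n ∈ Icc 1 x, (2 : ℝ) ^ n.primeFactors.card
      ≤ ∑ n ∈ Icc 1 x, y ^ (∑ i, ((((![X, X] : Fin 2 → ℤ[X]) i).eval (n : ℤ)).toNat.factorization.sum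
          fun _ v => min v 2)) := by
        refine Finset.sum_le_sum fun n _ => ?_
        calc (2 : ℝ) ^ n.primeFactors.card ≤ (y ^ 2) ^ n.primeFactors.card :=
              pow_le_pow_left₀ (by norm_num) hy _
          _ = y ^ (2 * n.primeFactors.card) := (pow_mul y 2 _).symm
          _ ≤ y ^ (∑ i, ((((![X, X] : Fin 2 → ℤ[X]) i).eval (n : ℤ)).toNat.factorization.sum fun _ v => min v 2)) :=
              pow_le_pow_right₀ hy1 (by rw [stat_pair]; have := omega_le_capped n; omega)
    _ ≤ ∑ n ∈ Finset.range (x + 1), y ^ (∑ i, ((((![X, X] : Fin 2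
        → ℤ[X]) i).eval (n : ℤ)).toNat.factorization.sum fun _ v => min v 2)) :=
        Finset.sum_le_sum_of_subset_of_nonneg (fun n hn => by
          simp only [Finset.mem_Icc, Finset.mem_range] at hn ⊢; omega) fun _ _ _ => by positivity

/-- DROP `pairwise_not_associated` ⇒ FALSE. Witness `k = 2`, `f = ![X, X]` (both irreducible, leading
coefficient `1`, `ω(p) = 1 < p`; NB `C(X, X) = ∏_p (1-1/p)^{-1} = +∞`, so `batemanHornConst` is junk and the
refutation must come from DIVERGENCE): `s_f = 2 s(n) ≥ 2 ω(n)`, so at `y = 29/20` (`y² = 841/400 ≥ 2`,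
`k(y-1) = 9/10 < 1`) the normalised sum is `≥ ½ (log x)^{1/10} - 1 → ∞`. [folklore] -/
theorem false_without_pairwise_not_associated :
    ¬ ∀ (k : ℕ) (f : Fin k → ℤ[X]), (∀ i, Irreducible (f i)) → (∀ i, 0 < (f i).leadingCoeff) →
      HasNoFixedPrimeDivisor f →
      ∃ Λ : ℂ → ℂ, DifferentiableOn ℂ Λ (Metric.ball 0 2) ∧ Λ 0 = (batemanHornConst f : ℂ) ∧
        ∀ y : ℝ, 5 / 4 < y → y < 7 / 4 → Filter.Tendsto (fun x : ℕ => (x : ℂ)⁻¹ *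
          Complex.exp ((k : ℂ) * (1 - (y : ℂ)) * (Real.log (Real.log x) : ℂ)) *
          ∑ n ∈ Finset.range (x + 1), (y : ℂ) ^ (∑ i, (((f i).eval (n : ℤ)).toNat.factorization.sum
              fun _ v => min v 2))) Filter.atTop
          (nhds (Λ y * Complex.exp (((y : ℂ) - 1) * (Real.log (∏ i, ((f i).natDegree : ℝ)) : ℂ)) *
            (Complex.Gamma y)⁻¹ ^ k)) := by
  intro h
  obtain ⟨Λ, _, _, hlaw⟩ := h 2 ![X, X]
    (fun i => by fin_cases i <;> simpa using Polynomial.prime_X.irreducible)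
    (fun i => by fin_cases i <;> simp)
    (fun p hp => by rw [polyRootCountMod_eq_one pair_dvd_iff hp]; exact hp.one_lt)
  have hlim := (hlaw (29 / 20) (by norm_num) (by norm_num)).congr fun x => normSum_eq_ofReal 2 ![X, X] (29 / 20) x
  refine not_tendsto_ofReal_of_tendsto_atTop ?_ _ hlim
  exact tendsto_atTop_of_lower_envelope (by norm_num) (by norm_num)
    fun x _ => sum_stat_pair_ge (by norm_num) (by norm_num) x

/-! ## (d) `hasNoFixedPrimeDivisor` is NOT load-bearing — the junk model `![C 3]`

With `hasNoFixedPrimeDivisor` dropped the crux is (conjecturally) STILL TRUE: a fixed prime divisor `p₀` kills the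
Euler factor at `0` on both sides (`E_{p₀}(0) = 0`, and the partial products of `C(f)` contain `1 - p₀/p₀ = 0`),
so `Λ(0) = 0 = C(f)` consistently while the segment law keeps its shape. The junk model `![C 3]` satisfies the
three other fields, violates `hasNoFixedPrimeDivisor`, and SATISFIES the conclusion. -/

/-- `![C 3]` has the fixed prime divisor `3`: `ω(3) = 3`. [folklore] -/
theorem polyRootCountMod_C_three : polyRootCountMod ![(C 3 : ℤ[X])] 3 = 3 := by
  unfold polyRootCountMod
  simp

/-- … hence it is NOT a Bateman–Horn system, [folklore] -/
theorem not_hasNoFixedPrimeDivisor_C_three : ¬HasNoFixedPrimeDivisor ![(C 3 : ℤ[X])] := fun h => by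
  have := h 3 Nat.prime_three
  rw [polyRootCountMod_C_three] at this
  exact lt_irrefl _ this

/-- … although it satisfies the three other fields (`C 3` is irreducible in `ℤ[X]` since `3` is prime in `ℤ`;
leading coefficient `3 > 0`; pairwise vacuous), [folklore] -/
theorem C_three_other_fields :
    (∀ i, Irreducible ((![(C 3 : ℤ[X])]) i)) ∧ (∀ i, 0 < ((![(C 3 : ℤ[X])]) i).leadingCoeff) ∧
      Pairwise fun i j => ¬Associated ((![(C 3 : ℤ[X])]) i) ((![(C 3 : ℤ[X])]) j) := by
  refine ⟨fun i => ?_, fun i => ?_, Subsingleton.pairwise⟩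
  · simpa using (Polynomial.prime_C_iff.2 Int.prime_three).irreducible
  · simp only [Matrix.cons_val_fin_one, leadingCoeff_C]
    norm_num

/-- … its Bateman–Horn constant is `0` (the partial products vanish from `x = 3` on), [folklore] -/
theorem batemanHornConst_C_three : batemanHornConst ![(C 3 : ℤ[X])] = 0 := by
  refine HasBatemanHornConst.batemanHornConst_eq ?_
  refine (tendsto_const_nhds (x := (0 : ℝ))).congr' ?_
  filter_upwards [eventually_ge_atTop 3] with x hx
  unfold batemanHornPartial
  symm
  refine Finset.prod_eq_zero (i := 3) (by simp [Nat.mem_primesLE, hx, Nat.prime_three]) ?_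
  rw [polyRootCountMod_C_three]
  norm_num

/-- … its statistic is the constant `1` (`s(3) = 1`), [folklore] -/
theorem stat_C_three (n : ℕ) : (∑ i, ((((![(C 3 : ℤ[X])] : Fin 1
    → ℤ[X]) i).eval (n : ℤ)).toNat.factorization.sum fun _ v => min v 2)) = 1 := by
  simp only [Fin.sum_univ_one, Matrix.cons_val_fin_one, eval_C]
  rw [show ((3 : ℤ)).toNat = 3 from rfl, Nat.prime_three.factorization, Finsupp.sum_single_index] <;> simp

/-- … and it SATISFIES the conclusion of the crux with `Λ ≡ 0` (the normalised sum is
`x⁻¹(x+1)(log x)^{1-y} y → 0`, `C = 0`; `natDegree (C 3) = 0` enters only through `log 0 = 0`). So no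
refutation of the crux can come from a fixed prime divisor alone. [folklore] -/
theorem conclusion_C_three :
    ∃ Λ : ℂ → ℂ, DifferentiableOn ℂ Λ (Metric.ball 0 2) ∧ Λ 0 = (batemanHornConst ![(C 3 : ℤ[X])] : ℂ) ∧
      ∀ y : ℝ, 5 / 4 < y → y < 7 / 4 → Filter.Tendsto (fun x : ℕ => (x : ℂ)⁻¹ *
        Complex.exp (((1 : ℕ) : ℂ) * (1 - (y : ℂ)) * (Real.log (Real.log x) : ℂ)) *
        ∑ n ∈ Finset.range (x + 1), (y : ℂ) ^ (∑ i, ((((![(C 3 : ℤ[X])] : Fin 1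
            → ℤ[X]) i).eval (n : ℤ)).toNat.factorization.sum fun _ v => min v 2))) Filter.atTop
        (nhds (Λ y * Complex.exp (((y : ℂ) - 1) *
          (Real.log (∏ i, (((![(C 3 : ℤ[X])] : Fin 1 → ℤ[X]) i).natDegree : ℝ)) : ℂ)) *
          (Complex.Gamma y)⁻¹ ^ (1 : ℕ))) := by
  refine ⟨fun _ => 0, differentiableOn_const 0, by rw [batemanHornConst_C_three]; simp, fun y hy _ => ?_⟩
  rw [zero_mul, zero_mul]
  have h0 := tendsto_ofReal_of_tendsto (tendsto_zero_of_const_sum le_rfl (by linarith : (1 : ℝ) < y) y)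
  rw [Complex.ofReal_zero] at h0
  refine h0.congr fun x => ?_
  rw [normSum_eq_ofReal 1 _ y x]
  congr 1
  simp only [stat_C_three, pow_one, Finset.sum_const, Finset.card_range, nsmul_eq_mul]
  push_cast
  ring

/-! ## Certificates: the dropped-field statements are the route decl with one field removed -/

example (h : Summit.Parity.BatemanHorn.Theses.AlmostPrimeZeros.SystemLSDRealSegment) :
    ∀ (k : ℕ) (f : Fin k → ℤ[X]), (∀ i, Irreducible (f i)) → (∀ i, 0 < (f i).leadingCoeff) →
      (Pairwise fun i j => ¬Associated (f i) (f j)) → HasNoFixedPrimeDivisor f →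
      ∃ Λ : ℂ → ℂ, DifferentiableOn ℂ Λ (Metric.ball 0 2) ∧ Λ 0 = (batemanHornConst f : ℂ) ∧
        ∀ y : ℝ, 5 / 4 < y → y < 7 / 4 → Filter.Tendsto (fun x : ℕ => (x : ℂ)⁻¹ *
          Complex.exp ((k : ℂ) * (1 - (y : ℂ)) * (Real.log (Real.log x) : ℂ)) *
          ∑ n ∈ Finset.range (x + 1), (y : ℂ) ^ (∑ i, (((f i).eval (n : ℤ)).toNat.factorization.sum
              fun _ v => min v 2))) Filter.atTop
          (nhds (Λ y * Complex.exp (((y : ℂ) - 1) * (Real.log (∏ i, ((f i).natDegree : ℝ)) : ℂ)) *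
            (Complex.Gamma y)⁻¹ ^ k)) :=
  fun k f h1 h2 h3 h4 => h k f ⟨h1, h2, h3, h4⟩

end Summit.Parity.BatemanHorn.Theorems.SystemLSDRealSegment.Negative
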